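import Mathlib
import HarnessLib
import Summits.NavierStokesRegularity.NavierStokesRegularity.Theorems.UnthreadedRigidityDoorUnthreadedRigidityVirialHornOrderTwoLaw

/-!
# Route `UnthreadedRigidityDoor`, item `UnthreadedRigidity` (W2, stmt-NavierStokesRegularity-27585) — LINE g11-1 «VIRIAL HORN»:
# (F1) THE ISOTYPIC ORDER-ONE LAW (the L-part identity of bridge W `WindowWedgeAnalyticL`)

For an admissible `l`-isotypic datum `u₀ = isoShellL n c B x₀ = curl curl ((Σ_m c_m(|y|) B_m(y)) y)` (`B_m` solid harmonics of degree
`l ≥ 1`, `c_m` virial-admissible profiles, `y = x − x₀`) the FORMAL FIRST JET of the threading flux about `x₀` is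
`fluxJetOne u₀ x₀ (x₀ + y) = l(l+1) · Σ_{m,m′} K_l[c_m](|y|) c_{m′}(|y|) {B_m, B_{m′}}(y)`
(`K_l[c] = c″ + 2(l+1)c′/r = vortAmpL l c`; by antisymmetry of the bracket this is
`l(l+1) Σ_{m<m′} (K_l[c_m] c_{m′} − K_l[c_{m′}] c_m){B_m,B_{m′}} = −l(l+1) Σ_{m<m′} r^{−2l−2}(r^{2l+2} W_{mm′})′ {B_m,B_{m′}}`,
`W_{mm′} = c_m c_{m′}′ − c_{m′} c_m′` — VIRIAL HORN card §6 (F1)).  LEMMA SEP (`n = 1`, p706546) is the diagonal case.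
* `inner_curl_fluxOne_eq_fderiv` — ORDER-ONE STRUCTURE: for a smooth divergence-free `P` whose vorticity `ω` is tangent to the spheres
  and has `curl curl ω` tangent to the spheres, `⟪curl(ΔP − (P·∇)P)(y), y⟫ = D⟪P, ·⟫(y)[ω(y)]`;
* `fluxJetOne_comp_sub` — the first jet about `x₀` of a translate is the centred first jet;
* `fluxJetOne_isoShell_centred` — the law for `P = Σ_m curl curl ((h_m(|y|²) B_m) y)` with the explicit profiles `k_m = 2a_m′ + b_m`;
* ★ `fluxJetOne_isoShellL_eq` — the law for `isoShellL n c B x₀` with `IsoAdmissibleL l n c B`, in the tree's `vortAmpL`.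

HONEST LABEL: explicit-field calculus (an L-part) on a RUNG line about SPECIAL isotypic data; bridge W also needs the injectivity of
`Y ∧ Z ↦ {Y,Z}` on `Λ²V_l` and its M-part, untouched here; `UnthreadedRigidity` (27585), W2 and NS regularity remain OPEN; nothing
here is a statement about solutions of the Navier–Stokes equations.  `--supports stmt-NavierStokesRegularity-27585` (helper);
ns-crc-p2 g8.  [cite: MajdaBertozziCUP2002, §1.1 (vector identities), §2.1 (Lamb form)]
-/

-- the summit and its single sub-problem share the name (CONVENTIONS §1)
set_option linter.dupNamespace false

namespace Summit.NavierStokesRegularity.NavierStokesRegularity.Theorems.UnthreadedRigidity.VirialHorn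

open scoped Topology Laplacian
open Filter Set Function
open Summit.NavierStokesRegularity.NavierStokesRegularity.Theorems.UnthreadedRigidity.ProfileHorn (E3)
open Literature.Analysis.FluidPDE

/-! ## §1 The order-one structure -/

/-- ORDER-ONE STRUCTURE: for a smooth divergence-free field `P` whose vorticity `ω = curl P` is tangent to the spheres about `0` and
whose `curl curl ω` is tangent to the spheres as well, `⟪curl(ΔP − (P·∇)P)(y), y⟫ = D(z ↦ ⟪P z, z⟫)(y)[ω y]`
(`ΔP = −curl ω`; Lamb form; `⟪curl(ω × P), y⟫ = −D⟪P,·⟫[ω]` by `curl_cross_apply` for the tangent divergence-free `ω`).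
[cite: MajdaBertozziCUP2002, §1.1, §2.1] -/
theorem inner_curl_fluxOne_eq_fderiv {P ω : E3 → E3} (hP : ContDiff ℝ (⊤ : ℕ∞) P) (hdiv : VectorCalculus.IsDivFree P)
    (hω_def : ω = curl P) (htan : ∀ z : E3, inner ℝ (ω z) z = 0) (hcc : ∀ z : E3, inner ℝ (curl (curl ω) z) z = 0) (y : E3) :
    inner ℝ (curl (fun z : E3 => (Δ P) z - convect P P z) y) y = fderiv ℝ (fun z : E3 => inner ℝ (P z) z) y (ω y) := by
  -- regularity
  have hP2 : ContDiff ℝ 2 P := hP.of_le (by norm_cast)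
  have hPd : Differentiable ℝ P := hP.differentiable (by simp)
  have hωs : ContDiff ℝ (⊤ : ℕ∞) ω := by
    have : ContDiff ℝ ((⊤ : ℕ∞) + 1) P := by simpa using hP
    rw [hω_def]
    exact contDiff_curl this
  have hωd : Differentiable ℝ ω := hωs.differentiable (by simp)
  have hcωd : Differentiable ℝ (curl ω) := by
    have : ContDiff ℝ ((⊤ : ℕ∞) + 1) ω := by simpa using hωs
    exact (contDiff_curl this).differentiable (by simp)
  -- `ΔP = −curl ω` and the Lamb form
  have hlap : (fun z : E3 => (Δ P) z) = fun z => -curl ω z := by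
    funext z
    rw [hω_def, curl_curl_eq_neg_laplacian hP2 hdiv z, neg_neg]
  obtain ⟨q, hq_def⟩ : ∃ q : E3 → ℝ, q = fun z => ‖P z‖ ^ 2 / 2 := ⟨_, rfl⟩
  have hq : ContDiff ℝ 2 q := by
    have : ContDiff ℝ 2 (fun z : E3 => ‖P z‖ ^ 2) := hP2.norm_sq ℝ
    rw [hq_def]
    exact this.div_const 2
  have hlamb : (fun z : E3 => convect P P z) = fun z => cross (ω z) (P z) + gradient q z := by
    funext z
    rw [hω_def, hq_def]
    exact convect_self_eq_cross_curl_add_gradient (hPd z)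
  have hinner : (fun z : E3 => (Δ P) z - convect P P z) = fun z => -curl ω z - (cross (ω z) (P z) + gradient q z) := by
    funext z
    have e1 := congrFun hlap z
    have e2 := congrFun hlamb z
    rw [e1, e2]
  have hgq : Differentiable ℝ (gradient q) := by
    have h1 : ContDiff ℝ 1 (fderiv ℝ q) := hq.fderiv_right (m := 1) (by norm_cast)
    exact (InnerProductSpace.toDual ℝ E3).symm.differentiable.comp (h1.differentiable (by simp))
  have hcrossd : Differentiable ℝ (fun z : E3 => cross (ω z) (P z)) := fun z =>
    (hasFDerivAt_cross (hωd z).hasFDerivAt (hPd z).hasFDerivAt).differentiableAt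
  have hneg : DifferentiableAt ℝ (fun z : E3 => -curl ω z) y := (hcωd y).neg
  have hadd : DifferentiableAt ℝ (fun z : E3 => cross (ω z) (P z) + gradient q z) y := (hcrossd y).add (hgq y)
  have hcurl_split : curl (fun z : E3 => -curl ω z - (cross (ω z) (P z) + gradient q z)) y =
      -curl (curl ω) y - (curl (fun z : E3 => cross (ω z) (P z)) y + curl (gradient q) y) := by
    rw [curl_sub hneg hadd, curl_neg, curl_add (hcrossd y) (hgq y)]
  rw [hinner, hcurl_split, curl_gradient_eq_zero_holds q hq y, add_zero, inner_sub_left, inner_neg_left, hcc y,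
    neg_zero, zero_sub]
  -- `⟪curl (ω × P) y, y⟫ = D⟪P, ·⟫(y)[ω y]`
  have hdivω : VectorCalculus.divergence ω y = 0 := by
    rw [hω_def]
    exact divergence_curl_eq_zero_holds P hP2 y
  rw [curl_cross_apply (hωd y) (hPd y), hdivω, hdiv y, zero_smul, zero_smul, sub_zero, add_zero, inner_sub_left,
    inner_fderiv_of_tangent (hωd y) htan]
  have hmd : HasFDerivAt (fun z : E3 => inner ℝ (P z) z)
      ((fderivInnerCLM ℝ (P y, y)).comp ((fderiv ℝ P y).prod (ContinuousLinearMap.id ℝ E3))) y :=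
    (hPd y).hasFDerivAt.inner ℝ (hasFDerivAt_id y)
  rw [hmd.fderiv]
  simp only [ContinuousLinearMap.comp_apply, ContinuousLinearMap.prod_apply, ContinuousLinearMap.id_apply,
    fderivInnerCLM_apply]
  rw [real_inner_comm (ω y) (P y)]
  ring

/-- THE FIRST JET ABOUT `x₀` OF A TRANSLATE is the centred first jet: `fluxJetOne (P(· − x₀)) x₀ x = fluxJetOne P 0 (x − x₀)`
(Laplacian, convective derivative and curl commute with translations; no differentiability needed). [folklore] -/
theorem fluxJetOne_comp_sub (P : E3 → E3) (x₀ x : E3) :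
    ThreadingJets.fluxJetOne (fun z : E3 => P (z - x₀)) x₀ x = ThreadingJets.fluxJetOne P 0 (x - x₀) := by
  obtain ⟨G, hG⟩ : ∃ G : E3 → E3, G = fun w : E3 => (Δ P) w - convect P P w := ⟨_, rfl⟩
  have hin : (fun z : E3 => (Δ fun w : E3 => P (w - x₀)) z - convect (fun w : E3 => P (w - x₀)) (fun w : E3 => P (w - x₀)) z) =
      fun z : E3 => G (z - x₀) := by
    funext z
    rw [hG]
    simp only [laplacian_comp_sub_const P x₀ z, convect_apply, fderiv_comp_sub]
  unfold ThreadingJets.fluxJetOne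
  rw [hin, curl_comp_sub_const_fun G x₀, ← hG, sub_zero]

/-- antisymmetry of the bracket: `{f, g} = −{g, f}`. [folklore] -/
theorem pbr_swap (f g : E3 → ℝ) (y : E3) : pbr f g y = -pbr g f y := by
  simp only [pbr, det3]
  ring

/-! ## §2 The law for a centred isotypic sum of shells -/

section Centred

variable {l n : ℕ} {h : Fin n → ℝ → ℝ} {B : Fin n → E3 → ℝ}

/-- ★ THE ISOTYPIC ORDER-ONE LAW, CENTRED: for `P = curl curl ((Σ_m h_m(|y|²) B_m) y)` with smooth `h_m` and solid harmonics `B_m` of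
degree `l ≥ 1`, and the profiles `a_m = 2 s h_m′ + (l+1) h_m`, `b_m = 2 l h_m′`, `k_m = 2 a_m′ + b_m` (so `curl curl((h_m B_m)y) =
a_m ∇B_m − (b_m B_m) y` has vorticity `−k_m (∇B_m × y)`):
`⟪curl(ΔP − (P·∇)P)(y), y⟫ = l(l+1) Σ_m Σ_{m′} k_m(|y|²) h_{m′}(|y|²) {B_m, B_{m′}}(y)`. [cite: MajdaBertozziCUP2002, §1.1, §2.1] -/
theorem fluxJetOne_isoShell_centred (hl : 1 ≤ l) (hh : ∀ m, ContDiff ℝ (⊤ : ℕ∞) (h m)) (hB : ∀ m, IsSolidHarmonic l (B m))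
    {a b k : Fin n → ℝ → ℝ}
    (ha_def : ∀ m, a m = fun s => 2 * s * deriv (h m) s + ((l : ℝ) + 1) * h m s)
    (hb_def : ∀ m, b m = fun s => 2 * (l : ℝ) * deriv (h m) s)
    (hk_def : ∀ m, k m = fun s => 2 * deriv (a m) s + b m s) {P : E3 → E3}
    (hPe : P = curl (curl (fun z : E3 => ∑ m, (h m (‖z‖ ^ 2) * B m z) • z))) (y : E3) :
    inner ℝ (curl (fun z : E3 => (Δ P) z - convect P P z) y) y =
      ((l : ℝ) * ((l : ℝ) + 1)) * ∑ m, ∑ m', k m (‖y‖ ^ 2) * h m' (‖y‖ ^ 2) * pbr (B m) (B m') y := by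
  -- profiles
  have hh' : ∀ m, ContDiff ℝ (⊤ : ℕ∞) (deriv (h m)) := fun m => contDiff_deriv_of_contDiff_top (hh m)
  have ha : ∀ m, ContDiff ℝ (⊤ : ℕ∞) (a m) := fun m => by
    rw [ha_def m]
    exact ((contDiff_const.mul contDiff_id).mul (hh' m)).add (contDiff_const.mul (hh m))
  have hb : ∀ m, ContDiff ℝ (⊤ : ℕ∞) (b m) := fun m => by
    rw [hb_def m]
    exact contDiff_const.mul (hh' m)
  have hk : ∀ m, ContDiff ℝ (⊤ : ℕ∞) (k m) := fun m => by
    rw [hk_def m]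
    exact (contDiff_const.mul (contDiff_deriv_of_contDiff_top (ha m))).add (hb m)
  have hkd : ∀ m, Differentiable ℝ (k m) := fun m => (hk m).differentiable (by simp)
  have hhd : ∀ m, Differentiable ℝ (h m) := fun m => (hh m).differentiable (by simp)
  have hBd : ∀ m, Differentiable ℝ (B m) := fun m => (hB m).contDiff.differentiable (by simp)
  -- the shells `f m`, their sum, and `P = Σ_m curl curl (f m)`
  set f : Fin n → E3 → E3 := fun m z => (h m (‖z‖ ^ 2) * B m z) • z with hf
  have hfs : ∀ m, ContDiff ℝ (⊤ : ℕ∞) (f m) := fun m => contDiff_shell (hh m) (hB m)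
  have hfd : ∀ m, Differentiable ℝ (f m) := fun m => (hfs m).differentiable (by simp)
  have hcfs : ∀ m, ContDiff ℝ (⊤ : ℕ∞) (curl (f m)) := fun m => by
    have : ContDiff ℝ ((⊤ : ℕ∞) + 1) (f m) := by simpa using hfs m
    exact contDiff_curl this
  have hcfd : ∀ m, Differentiable ℝ (curl (f m)) := fun m => (hcfs m).differentiable (by simp)
  have hccfs : ∀ m, ContDiff ℝ (⊤ : ℕ∞) (curl (curl (f m))) := fun m => by
    have : ContDiff ℝ ((⊤ : ℕ∞) + 1) (curl (f m)) := by simpa using hcfs m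
    exact contDiff_curl this
  have hsum : (fun z : E3 => ∑ m, (h m (‖z‖ ^ 2) * B m z) • z) = fun z : E3 => ∑ m, f m z := by
    funext z
    simp only [hf]
  have hPsum : P = fun z : E3 => ∑ m, curl (curl (f m)) z := by
    rw [hPe, hsum]
    have hcurl1 : curl (fun z : E3 => ∑ m, f m z) = fun z : E3 => ∑ m, curl (f m) z := by
      funext z
      exact curl_finset_sum Finset.univ fun m _ => hfd m z
    rw [hcurl1]
    funext z
    exact curl_finset_sum Finset.univ fun m _ => hcfd m z
  have hP : ContDiff ℝ (⊤ : ℕ∞) P := by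
    rw [hPsum]
    exact ContDiff.sum fun m _ => hccfs m
  have hdiv : VectorCalculus.IsDivFree P := by
    intro z
    rw [hPe]
    have hF : ContDiff ℝ (⊤ : ℕ∞) (fun z : E3 => ∑ m, (h m (‖z‖ ^ 2) * B m z) • z) := by
      rw [hsum]
      exact ContDiff.sum fun m _ => hfs m
    have hcF : ContDiff ℝ 2 (curl (fun z : E3 => ∑ m, (h m (‖z‖ ^ 2) * B m z) • z)) := by
      have : ContDiff ℝ (2 + 1) (fun z : E3 => ∑ m, (h m (‖z‖ ^ 2) * B m z) • z) := hF.of_le (by norm_cast)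
      exact contDiff_curl this
    exact divergence_curl_eq_zero_holds _ hcF z
  -- the explicit shells and their toroidal vorticities
  have hPm : ∀ m, curl (curl (f m)) = fun z : E3 => a m (‖z‖ ^ 2) • gradient (B m) z - (b m (‖z‖ ^ 2) * B m z) • z := by
    intro m
    funext z
    rw [hf, curl_curl_shell_apply ((hh m).of_le (by norm_cast)) (hB m) z, ha_def m, hb_def m]
  have hωm : ∀ m, curl (curl (curl (f m))) = fun z : E3 => -(k m (‖z‖ ^ 2) • cross (gradient (B m) z) z) := by
    intro m
    rw [hPm m]
    funext z
    rw [curl_explicitShell_apply ((ha m).of_le (by norm_cast)) ((hb m).of_le (by norm_cast)) (hB m) z, hk_def m]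
  obtain ⟨ω, hω_def⟩ : ∃ ω : E3 → E3, ω = curl P := ⟨_, rfl⟩
  have hccfd : ∀ m, Differentiable ℝ (curl (curl (f m))) := fun m => (hccfs m).differentiable (by simp)
  have hω_sum : ω = fun z : E3 => ∑ m, -(k m (‖z‖ ^ 2) • cross (gradient (B m) z) z) := by
    rw [hω_def, hPsum]
    funext z
    rw [curl_finset_sum Finset.univ fun m _ => hccfd m z]
    exact Finset.sum_congr rfl fun m _ => congrFun (hωm m) z
  -- each summand of `ω` is minus the curl of a shell potential, hence smooth with toroidal `curl curl`
  have hωm_shell : ∀ m, (fun z : E3 => -(k m (‖z‖ ^ 2) • cross (gradient (B m) z) z)) =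
      fun z : E3 => -curl (fun w : E3 => (k m (‖w‖ ^ 2) * B m w) • w) z := by
    intro m
    rw [curl_shell_eq (hkd m) (hBd m)]
  have hgs : ∀ m, ContDiff ℝ (⊤ : ℕ∞) (fun w : E3 => (k m (‖w‖ ^ 2) * B m w) • w) := fun m => contDiff_shell (hk m) (hB m)
  have hcgs : ∀ m, ContDiff ℝ (⊤ : ℕ∞) (curl (fun w : E3 => (k m (‖w‖ ^ 2) * B m w) • w)) := fun m => by
    have : ContDiff ℝ ((⊤ : ℕ∞) + 1) (fun w : E3 => (k m (‖w‖ ^ 2) * B m w) • w) := by simpa using hgs m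
    exact contDiff_curl this
  have hccgs : ∀ m, ContDiff ℝ (⊤ : ℕ∞) (curl (curl (fun w : E3 => (k m (‖w‖ ^ 2) * B m w) • w))) := fun m => by
    have : ContDiff ℝ ((⊤ : ℕ∞) + 1) (curl (fun w : E3 => (k m (‖w‖ ^ 2) * B m w) • w)) := by simpa using hcgs m
    exact contDiff_curl this
  have hωms : ∀ m, ContDiff ℝ (⊤ : ℕ∞) (fun z : E3 => -(k m (‖z‖ ^ 2) • cross (gradient (B m) z) z)) := fun m => by
    rw [hωm_shell m]
    exact (hcgs m).neg
  have hωmd : ∀ m, Differentiable ℝ (fun z : E3 => -(k m (‖z‖ ^ 2) • cross (gradient (B m) z) z)) := fun m =>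
    (hωms m).differentiable (by simp)
  have hcωm : ∀ m, curl (fun z : E3 => -(k m (‖z‖ ^ 2) • cross (gradient (B m) z) z)) =
      fun z : E3 => -curl (curl (fun w : E3 => (k m (‖w‖ ^ 2) * B m w) • w)) z := by
    intro m
    rw [hωm_shell m]
    funext z
    exact curl_neg _ z
  have hcωmd : ∀ m, Differentiable ℝ (curl (fun z : E3 => -(k m (‖z‖ ^ 2) • cross (gradient (B m) z) z))) := fun m => by
    rw [hcωm m]
    exact ((hccgs m).differentiable (by simp)).neg
  -- (T1) `ω` is tangent to the spheres
  have htan : ∀ z : E3, inner ℝ (ω z) z = 0 := fun z => by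
    rw [hω_sum]
    simp only [sum_inner, inner_neg_left, inner_smul_left, inner_cross_self_right, mul_zero, neg_zero,
      Finset.sum_const_zero]
  -- (T2) `curl curl ω` is tangent to the spheres
  have hcc : ∀ z : E3, inner ℝ (curl (curl ω) z) z = 0 := by
    intro z
    have e1 : curl ω = fun w : E3 => ∑ m, curl (fun z : E3 => -(k m (‖z‖ ^ 2) • cross (gradient (B m) z) z)) w := by
      rw [hω_sum]
      funext w
      exact curl_finset_sum Finset.univ fun m _ => hωmd m w
    rw [e1, curl_finset_sum Finset.univ fun m _ => hcωmd m z, sum_inner]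
    refine Finset.sum_eq_zero fun m _ => ?_
    obtain ⟨k₂, -, hk₂⟩ := exists_curl_curl_curl_shell (hk m) (hB m)
    rw [hcωm m, curl_neg, hk₂]
    simp only [neg_neg, inner_smul_left, conj_trivial, inner_cross_self_right, mul_zero]
  rw [inner_curl_fluxOne_eq_fderiv hP hdiv hω_def htan hcc y]
  -- `⟪P z, z⟫ = l(l+1) Σ_m h_m(|z|²) B_m z`
  have hm : (fun z : E3 => inner ℝ (P z) z) = fun z : E3 => ∑ m, ((l : ℝ) * ((l : ℝ) + 1)) * (h m (‖z‖ ^ 2) * B m z) := by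
    funext z
    rw [hPsum]
    simp only [sum_inner]
    refine Finset.sum_congr rfl fun m _ => ?_
    rw [hf]
    exact inner_curl_curl_shell_self ((hh m).of_le (by norm_cast)) (hB m) hl z
  rw [hm]
  -- differentiate the sum along `ω y ⊥ y, ∇B_{m′}`-wise
  have hωy : ω y = ∑ m, -(k m (‖y‖ ^ 2) • cross (gradient (B m) y) y) := congrFun hω_sum y
  have hyω : inner ℝ y (ω y) = 0 := by rw [real_inner_comm]; exact htan y
  have hterm : ∀ m', HasFDerivAt (fun z : E3 => ((l : ℝ) * ((l : ℝ) + 1)) * (h m' (‖z‖ ^ 2) * B m' z))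
      (((l : ℝ) * ((l : ℝ) + 1)) • (h m' (‖y‖ ^ 2) • fderiv ℝ (B m') y
        + B m' y • (deriv (h m') (‖y‖ ^ 2) • (2 • innerSL ℝ y)))) y := by
    intro m'
    have hH : HasFDerivAt (fun z : E3 => h m' (‖z‖ ^ 2)) (deriv (h m') (‖y‖ ^ 2) • (2 • innerSL ℝ y)) y :=
      ((hhd m' (‖y‖ ^ 2)).hasDerivAt).comp_hasFDerivAt y (hasStrictFDerivAt_norm_sq y).hasFDerivAt
    exact (hH.mul (hBd m' y).hasFDerivAt).const_mul _
  rw [(HasFDerivAt.fun_sum fun m' _ => hterm m').fderiv, sum_apply]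
  -- `DB_{m′}(y)[ω y] = Σ_m k_m {B_m, B_{m′}}`
  have hdir : ∀ m', fderiv ℝ (B m') y (ω y) = ∑ m, k m (‖y‖ ^ 2) * pbr (B m) (B m') y := by
    intro m'
    rw [← inner_gradient_left, hωy, inner_sum]
    refine Finset.sum_congr rfl fun m _ => ?_
    rw [inner_neg_right, real_inner_smul_right, inner_gradient_cross_gradient_self, pbr_swap]
    ring
  simp only [smul_apply, add_apply, innerSL_apply_apply, hyω, smul_zero, hdir, smul_eq_mul, mul_zero, add_zero,
    Finset.mul_sum]
  refine Finset.sum_comm.trans ?_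
  refine Finset.sum_congr rfl fun m _ => Finset.sum_congr rfl fun m' _ => ?_
  ring

end Centred

/-! ## §3 ★ The law for `isoShellL n c B x₀` -/

/-- ★ (F1) THE ISOTYPIC ORDER-ONE LAW: for an admissible `l`-isotypic family (`IsoAdmissibleL l n c B`, `l ≥ 1`) and any centre `x₀`,
`fluxJetOne (isoShellL n c B x₀) x₀ (x₀ + y) = l(l+1) · Σ_m Σ_{m′} K_l[c_m](|y|) · c_{m′}(|y|) · {B_m, B_{m′}}(y)`
(`K_l[c] = vortAmpL l c = c″ + 2(l+1)c′/r`).  The diagonal terms vanish (`{B,B} = 0`), so for `n = 1` this is LEMMA SEP; by antisymmetry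
the right side is `l(l+1) Σ_{m<m′} (K_l[c_m] c_{m′} − K_l[c_{m′}] c_m){B_m,B_{m′}}`, the Wronskian form of VIRIAL HORN card §6 (F1).
[cite: MajdaBertozziCUP2002, §1.1, §2.1] -/
theorem fluxJetOne_isoShellL_eq {l n : ℕ} (hl : 1 ≤ l) {c : Fin n → ℝ → ℝ} {B : Fin n → E3 → ℝ}
    (hadm : IsoAdmissibleL l n c B) (x₀ y : E3) :
    ThreadingJets.fluxJetOne (isoShellL n c B x₀) x₀ (x₀ + y) =
      ((l : ℝ) * ((l : ℝ) + 1)) * ∑ m, ∑ m', vortAmpL l (c m) ‖y‖ * c m' ‖y‖ * pbr (B m) (B m') y := by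
  choose h hh hc using fun m => (hadm.2 m).1
  -- the datum is the translate of the centred sum of shells `P`
  obtain ⟨P, hPe⟩ : ∃ P : E3 → E3, P = curl (curl (fun z : E3 => ∑ m, (h m (‖z‖ ^ 2) * B m z) • z)) := ⟨_, rfl⟩
  have hG : (fun x : E3 => (∑ m, c m ‖x - x₀‖ * B m (x - x₀)) • (x - x₀)) =
      fun x : E3 => (fun z : E3 => ∑ m, (h m (‖z‖ ^ 2) * B m z) • z) (x - x₀) := by
    funext x
    simp only [Finset.sum_smul]
    refine Finset.sum_congr rfl fun m _ => ?_
    rw [hc m ‖x - x₀‖ (norm_nonneg _)]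
  have hv : isoShellL n c B x₀ = fun x : E3 => P (x - x₀) := by
    unfold isoShellL
    rw [hG, curl_comp_sub_const_fun (fun z : E3 => ∑ m, (h m (‖z‖ ^ 2) * B m z) • z) x₀,
      curl_comp_sub_const_fun (curl (fun z : E3 => ∑ m, (h m (‖z‖ ^ 2) * B m z) • z)) x₀, hPe]
  rw [hv, fluxJetOne_comp_sub, add_sub_cancel_left]
  unfold ThreadingJets.fluxJetOne
  rw [sub_zero]
  -- the centred law with the explicit profiles
  obtain ⟨a, ha⟩ : ∃ a : Fin n → ℝ → ℝ, a = fun m s => 2 * s * deriv (h m) s + ((l : ℝ) + 1) * h m s := ⟨_, rfl⟩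
  obtain ⟨b, hb⟩ : ∃ b : Fin n → ℝ → ℝ, b = fun m s => 2 * (l : ℝ) * deriv (h m) s := ⟨_, rfl⟩
  obtain ⟨k, hk⟩ : ∃ k : Fin n → ℝ → ℝ, k = fun m s => 2 * deriv (a m) s + b m s := ⟨_, rfl⟩
  rw [fluxJetOne_isoShell_centred hl hh hadm.1 (fun m => congrFun ha m) (fun m => congrFun hb m)
    (fun m => congrFun hk m) hPe y]
  -- read-off of the profiles
  rcases eq_or_ne y 0 with hy | hy
  · subst hy
    simp only [pbr_apply_zero, mul_zero, Finset.sum_const_zero]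
  · have hr : 0 < ‖y‖ := norm_pos_iff.mpr hy
    have hcm : ∀ m, c m ‖y‖ = h m (‖y‖ ^ 2) := fun m => hc m ‖y‖ hr.le
    have hK : ∀ m, vortAmpL l (c m) ‖y‖ = k m (‖y‖ ^ 2) := by
      intro m
      rw [vortAmpL_eq_of_sq l (hh m) (hc m) hr, hk, hb]
      simp only [ha]
      rw [deriv_strainProfile (hh m) l]
      ring
    simp only [hK, hcm]

/-- THE WRONSKIAN FORM OF THE COEFFICIENTS: for profiles `c₁, c₂` twice differentiable at `r`,
`K_l[c₁](r) c₂(r) − K_l[c₂](r) c₁(r) = −(W′(r) + (2l+2) W(r)/r)` with the radial Wronskian `W = c₁ c₂′ − c₂ c₁′`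
(i.e. `= −r^{−2l−2}(r^{2l+2} W)′` for `r ≠ 0`): the coefficient of `{B_m,B_{m′}}` (`m < m′`) in the ISOTYPIC ORDER-ONE LAW is the Euler
derivative of the Wronskian of VIRIAL HORN card §6 (F1). [folklore] -/
theorem vortAmpL_mul_sub_eq_wronskian (l : ℕ) {c₁ c₂ : ℝ → ℝ} {r : ℝ}
    (h₁ : DifferentiableAt ℝ c₁ r) (h₂ : DifferentiableAt ℝ c₂ r)
    (h₁' : DifferentiableAt ℝ (deriv c₁) r) (h₂' : DifferentiableAt ℝ (deriv c₂) r) :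
    vortAmpL l c₁ r * c₂ r - vortAmpL l c₂ r * c₁ r =
      -(deriv (fun s : ℝ => c₁ s * deriv c₂ s - c₂ s * deriv c₁ s) r
        + (2 * (l : ℝ) + 2) / r * (c₁ r * deriv c₂ r - c₂ r * deriv c₁ r)) := by
  have hW : HasDerivAt (fun s : ℝ => c₁ s * deriv c₂ s - c₂ s * deriv c₁ s)
      (deriv c₁ r * deriv c₂ r + c₁ r * deriv (deriv c₂) r
        - (deriv c₂ r * deriv c₁ r + c₂ r * deriv (deriv c₁) r)) r :=
    (h₁.hasDerivAt.mul h₂'.hasDerivAt).sub (h₂.hasDerivAt.mul h₁'.hasDerivAt)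
  unfold vortAmpL
  rw [hW.deriv]
  ring

end Summit.NavierStokesRegularity.NavierStokesRegularity.Theorems.UnthreadedRigidity.VirialHorn
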